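import Mathlib.MeasureTheory.Integral.Prod
import Mathlib.MeasureTheory.Measure.OpenPos
import Literature.MeasureTheory.Lebesgue.SubconvolutionVanishing
import Literature.MathematicalPhysics.QuantumLattice.LiebWuRootCounting
import Literature.MathematicalPhysics.QuantumLattice.LiebWuRho0Bounds
import HarnessLib

/-!
# Identification of the thermodynamic limit of the Lieb–Wu roots: `μ = ρ₀ dk`
# (Goldbaum 2005, §5, movement 2) — F3a and F3 discharged

Family `hubbard`, statement hubbard.S10 (`lieb_wu`). `LiebWuRootDensityLimit` reduced the named fact
F3a `goldbaum_rootDensity_tendsto` (the empirical distribution of the Bethe momenta of the half-filled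
Hubbard ring converges weakly to Lieb–Wu's `ρ₀(k) dk`; Goldbaum, CMP 258 (2005) 317, §5, (5.16)) to
the identification of the joint weak subsequential limits `(μ, ν)` of the empirical measures of the
`k`'s and `Λ`'s, and `LiebWuRootCounting` proved that any such pair satisfies
`μ ≤ ρ̃_ν⁺ dk`, `ν ≤ σ̃_{μ,ν}⁺ dΛ`, `μ([-π, π]ᶜ) = 0` with
`ρ̃_ν(k) = 1/2π + cos k · ½∫K_{U/4}(sin k - t) dν(t)`,
`σ̃_{μ,ν}(Λ) = 2∫K_{U/4}(Λ - sin s) dμ(s) - ∫K_{U/2}(Λ - t) dν(t)`. This file proves that these three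
properties FORCE `μ = ρ₀ dk` on `[-π, π]` (`integral_rootLimit_eq_rho0`), hence
`goldbaum_rootDensity_tendsto_holds` (F3a) and, with the proved F3c,
`liebWu_betheEnergy_tendsto_holds` (F3). No densities, no `L²`-compactness and no a priori
knowledge of the accumulation sets `Q`, `B` are needed.

## The argument (a contraction, after Lieb–Wu 2003, §5–6)

Write `K = K_{U/4}`, `K² = K_{U/2}`, `u`, `r` for the kernels of Lieb–Wu's `K̂`, `K̂²`,
`Û = K̂²(1 + K̂²)⁻¹`, `R̂ = 2K̂(1 + K̂²)⁻¹` (`LiebWuKernels`: `u ≥ 0`, `∫u = 1/2`, `r > 0`, `∫r = 1`,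
`u ∗ K² = K² - u`, `u ∗ K = K - r/2`, `r ∗ K = 2u`), and `(f ⋄ μ)(y) = ∫ f(y - sin s) dμ(s)`.

* **Step A (`Λ`-side).** Fubini and the kernel identities give
  `σ̃ = r ⋄ μ + u ∗ σ̃ - u ∗ ν` (`liebWuLimitDensityΛ_eq_sech_add`; this is
  `(1 + K̂²)⁻¹ = 1 - Û` applied to `σ̃ = 2K ⋄ μ - K² ∗ ν`). Since `ν ≤ σ̃⁺` and `u, r ≥ 0`,
  `σ̃ ≥ -u ∗ σ̃⁻`, i.e. `σ̃⁻ ≤ u ∗ σ̃⁻`; as `∫u = 1/2 < 1`, `σ̃⁻ = 0`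
  (`SubconvolutionVanishing`), so `σ̃ ≥ 0`, `ν = σ̃ dΛ` (equal masses), `σ̃ = r ⋄ μ`, and
  `½ K ∗ ν = ½ (K ∗ r) ⋄ μ = u ⋄ μ`: **`ρ̃(k) = 1/2π + cos k · F(sin k)`, `F = u ⋄ μ ≥ 0`**.
* **Step B (`k`-side).** From `μ ≤ ρ̃⁺ dk` on `[-π, π]`, folding the arcs `[π/2, π]`,
  `[-π, -π/2]` onto `[-π/2, π/2]` (same sine, opposite cosine) gives, with
  `G(θ) = (cos θ F(sin θ) - 1/2π)⁺`,
  `F(x) ≤ π⁻¹∫_{-π/2}^{π/2} u(x - sin θ) dθ + ∫_{-π/2}^{π/2} G(θ) u(x - sin θ) dθ`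
  (`sinAverage_fermiKernel_le_fold`). Lieb–Wu's Lemma 5 in the form
  `∫_{-π/2}^{π/2} u(x - sin θ) dθ = I(U/2, x) < 1/(2√(1 - x²))` (`LiebWuKernels`,
  `BesselJZeroFermiIntegral`) turns this, at `x = sin θ'`, into `G ≤ TG` with
  `TG(θ') = cos θ' ∫ G(θ) u(sin θ' - sin θ) dθ`, whose kernel has column integrals
  `∫_{-1}^{1} u(v - sin θ) dv ≤ 1/2`; hence `∫G ≤ ½∫G`, `G ≡ 0` (`cos_mul_sinAverage_le`), so
  `ρ̃ ≥ 0` everywhere (`θ = arcsin(sin s)`), `μ = ρ̃ 1_{[-π,π]} dk` (`∫_{-π}^{π} ρ̃ = 1` because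
  `∫ cos k F(sin k) dk = 0`), then `F = u ⋄ μ = (2π)⁻¹ ∫_{-π}^{π} u(x - sin s) ds = π⁻¹ I(U/2, x)` and
  finally `ρ̃ = 1/2π + (cos k/π) I(U/2, sin k) = ρ₀` (`liebWuLimitDensityK_eq_rho0`).

## Relation to the printed proofs

Goldbaum (§5) passes to a.e.-convergent subsequences of the step densities, obtains the Lieb–Wu
integral equations (5.10)–(5.11) on the accumulation sets `Q`, `B`, quotes `Q = [-π, π]`, `B = ℝ`
from Lieb–Wu 2003, §5, Theorems 2–3, and the uniqueness of their solution (Theorem 1). The present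
proof replaces "limits of densities" by weak limits plus the counting inequalities, and the
`Q`/`B`-identification plus uniqueness by the positivity/contraction mechanism of Lieb–Wu's own
proof of Theorem 1 (`‖Û‖ = 1/2`, positive kernels of `Û`, `R̂`) and Lemma 5; every analytic input
is a proved theorem of the tree. F2c (`liebWu_minEnergyOn_szSector_eq_betheEnergy`) and F5b
(`liebWu_muMinus_tendsto`) remain the open nodes of `lieb_wu`; the epilogue records the resulting
trust base: part (i) of `lieb_wu` from F2c alone (`lieb_wu_energy_of_minEnergyOn_szSector`),
part (ii) from F5b alone (`lieb_wu_chargeGap_of_muMinus_tendsto`), and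
`lieb_wu_of_minEnergyOn_szSector_of_muMinus : F2c → F5b → lieb_wu`.

## References

* P. S. Goldbaum, CMP 258 (2005) 317–337 = arXiv:cond-mat/0403736 (key `Goldbaum2005`), §5.
* E. H. Lieb, F. Y. Wu, Physica A 321 (2003) 1–27 = arXiv:cond-mat/0207529 (key
  `LiebWuPhysicaA2003`), §5 (Theorem 1 and its proof, eq. (U), Lemma 3, Theorem 3), §6 (`ρ₀`,
  Lemma 5).
* Mathlib: `integral_integral_swap`, `integrable_prod_iff'`, `integral_withDensity_eq_integral_smul`,
  `Measure.eqOn_of_ae_eq`, `intervalIntegral.integral_comp_mul_deriv`,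
  `intervalIntegral_intervalIntegral_swap`, `Real.arcsin`.
-/

noncomputable section

open Filter Finset MeasureTheory Set Real
open Literature.Analysis.SpecialFunctions Literature.MeasureTheory.Lebesgue
open scoped Topology BigOperators ENNReal NNReal BoundedContinuousFunction

namespace Literature.MathematicalPhysics.QuantumLattice

/-! ### Toolkit: shifted averages `y ↦ ∫ f(y - ψ(s)) dm(s)` of an `L¹` function against a finite measure -/

section ShiftAverage

variable {f : ℝ → ℝ} {ψ : ℝ → ℝ} {m : Measure ℝ}

/-- `(y, s) ↦ f(y - ψ(s))` is integrable on `dy × m` for `f` continuous integrable, `ψ` continuous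
and `m` finite (its iterated norm integral is `‖f‖₁ · m(ℝ)`). [folklore] -/
theorem integrable_comp_sub_prod [IsFiniteMeasure m] (hf : Continuous f) (hfi : Integrable f)
    (hψ : Continuous ψ) : Integrable (fun p : ℝ × ℝ => f (p.1 - ψ p.2)) (volume.prod m) := by
  have hmeas : AEStronglyMeasurable (fun p : ℝ × ℝ => f (p.1 - ψ p.2)) (volume.prod m) :=
    (hf.comp (continuous_fst.sub (hψ.comp continuous_snd))).aestronglyMeasurable
  rw [integrable_prod_iff' hmeas]
  refine ⟨Eventually.of_forall fun s => hfi.comp_sub_right (ψ s), ?_⟩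
  have : (fun s => ∫ y, ‖f (y - ψ s)‖) = fun _ => ∫ y, ‖f y‖ := by
    funext s
    exact integral_sub_right_eq_self (fun y => ‖f y‖) (ψ s)
  rw [this]
  exact integrable_const _

/-- `y ↦ ∫ f(y - ψ(s)) dm(s)` is integrable. [folklore] -/
theorem integrable_integral_comp_sub [IsFiniteMeasure m] (hf : Continuous f) (hfi : Integrable f)
    (hψ : Continuous ψ) : Integrable (fun y => ∫ s, f (y - ψ s) ∂m) :=
  (integrable_comp_sub_prod hf hfi hψ).integral_prod_left

/-- `∫ (∫ f(y - ψ(s)) dm(s)) dy = (∫ f) · m(ℝ)`. [folklore] -/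
theorem integral_integral_comp_sub [IsFiniteMeasure m] (hf : Continuous f) (hfi : Integrable f)
    (hψ : Continuous ψ) : ∫ y, ∫ s, f (y - ψ s) ∂m = (∫ y, f y) * (m univ).toReal := by
  rw [integral_integral_swap ((integrable_comp_sub_prod hf hfi hψ) :
    Integrable (Function.uncurry fun y s => f (y - ψ s)) (volume.prod m))]
  have : (fun s => ∫ y, f (y - ψ s)) = fun _ => ∫ y, f y := by
    funext s
    exact integral_sub_right_eq_self f (ψ s)
  simp only [this, integral_const, smul_eq_mul, Measure.real]
  ring

/-- `y ↦ ∫ f(y - ψ(s)) dm(s)` is continuous when `f` is moreover bounded. [folklore] -/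
theorem continuous_integral_comp_sub [IsFiniteMeasure m] (hf : Continuous f) {B : ℝ}
    (hB : ∀ x, |f x| ≤ B) (hψ : Continuous ψ) : Continuous fun y => ∫ s, f (y - ψ s) ∂m := by
  refine continuous_of_dominated (bound := fun _ => B) (fun y => ?_) (fun y => ?_)
    (integrable_const _) (Eventually.of_forall fun s => ?_)
  · exact (hf.comp (continuous_const.sub hψ)).aestronglyMeasurable
  · exact Eventually.of_forall fun s => by rw [Real.norm_eq_abs]; exact hB _
  · exact hf.comp (continuous_id.sub continuous_const)

/-- `|∫ f(y - ψ(s)) dm(s)| ≤ B · m(ℝ)` if `|f| ≤ B`. [folklore] -/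
theorem abs_integral_comp_sub_le [IsFiniteMeasure m] {B : ℝ} (hB : ∀ x, |f x| ≤ B) (y : ℝ) :
    |∫ s, f (y - ψ s) ∂m| ≤ B * (m univ).toReal := by
  have h := norm_integral_le_of_norm_le_const (μ := m) (f := fun s => f (y - ψ s)) (C := B)
    (Eventually.of_forall fun s => by rw [Real.norm_eq_abs]; exact hB _)
  rw [Real.norm_eq_abs] at h
  simpa [Measure.real, mul_comm] using h

/-- `0 ≤ ∫ f(y - ψ(s)) dm(s)` if `f ≥ 0`. [folklore] -/
theorem integral_comp_sub_nonneg (hf0 : ∀ x, 0 ≤ f x) (y : ℝ) : 0 ≤ ∫ s, f (y - ψ s) ∂m :=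
  integral_nonneg fun _ => hf0 _

/-- **Fubini with a bounded weight**: for `h` continuous and bounded,
`∫ h(y) (∫ f(y - ψ(s)) dm(s)) dy = ∫ (∫ h(y) f(y - ψ(s)) dy) dm(s)`. [folklore] -/
theorem integral_mul_integral_comp_sub [IsFiniteMeasure m] (hf : Continuous f) (hfi : Integrable f)
    (hψ : Continuous ψ) {h : ℝ → ℝ} (hh : Continuous h) {B : ℝ} (hB : ∀ y, |h y| ≤ B) :
    ∫ y, h y * (∫ s, f (y - ψ s) ∂m) = ∫ s, (∫ y, h y * f (y - ψ s)) ∂m := by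
  have hB0 : 0 ≤ B := (abs_nonneg _).trans (hB 0)
  have hprod : Integrable (fun p : ℝ × ℝ => h p.1 * f (p.1 - ψ p.2)) (volume.prod m) := by
    refine Integrable.mono' ((integrable_comp_sub_prod hf hfi hψ).norm.const_mul B)
      ((hh.comp continuous_fst).mul (hf.comp (continuous_fst.sub (hψ.comp continuous_snd)))).aestronglyMeasurable
      (Eventually.of_forall fun p => ?_)
    rw [Real.norm_eq_abs, abs_mul, Real.norm_eq_abs]
    exact mul_le_mul_of_nonneg_right (hB _) (abs_nonneg _)
  have hprod' : Integrable (Function.uncurry fun y s => h y * f (y - ψ s)) (volume.prod m) := hprod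
  calc ∫ y, h y * (∫ s, f (y - ψ s) ∂m) = ∫ y, (∫ s, h y * f (y - ψ s) ∂m) :=
        integral_congr_ae (Eventually.of_forall fun y => (integral_const_mul (h y) _).symm)
    _ = ∫ s, (∫ y, h y * f (y - ψ s)) ∂m := integral_integral_swap hprod'


/-- `y ↦ ∫ f(y - t) dm(t)` is integrable (`ψ = id`). [folklore] -/
theorem integrable_integral_sub [IsFiniteMeasure m] (hf : Continuous f) (hfi : Integrable f) :
    Integrable (fun y => ∫ t, f (y - t) ∂m) :=
  integrable_integral_comp_sub (ψ := id) hf hfi continuous_id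

/-- `∫ (∫ f(y - t) dm(t)) dy = (∫ f) · m(ℝ)` (`ψ = id`). [folklore] -/
theorem integral_integral_sub [IsFiniteMeasure m] (hf : Continuous f) (hfi : Integrable f) :
    ∫ y, (∫ t, f (y - t) ∂m) = (∫ y, f y) * (m univ).toReal :=
  integral_integral_comp_sub (ψ := id) hf hfi continuous_id

/-- `y ↦ ∫ f(y - t) dm(t)` is continuous for bounded continuous `f` (`ψ = id`). [folklore] -/
theorem continuous_integral_sub [IsFiniteMeasure m] (hf : Continuous f) {B : ℝ}
    (hB : ∀ x, |f x| ≤ B) : Continuous fun y => ∫ t, f (y - t) ∂m :=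
  continuous_integral_comp_sub (ψ := id) hf hB continuous_id

/-- Fubini with a bounded weight (`ψ = id`):
`∫ h(y) (∫ f(y - t) dm(t)) dy = ∫ (∫ h(y) f(y - t) dy) dm(t)`. [folklore] -/
theorem integral_mul_integral_sub [IsFiniteMeasure m] (hf : Continuous f) (hfi : Integrable f)
    {h : ℝ → ℝ} (hh : Continuous h) {B : ℝ} (hB : ∀ y, |h y| ≤ B) :
    ∫ y, h y * (∫ t, f (y - t) ∂m) = ∫ t, (∫ y, h y * f (y - t)) ∂m :=
  integral_mul_integral_comp_sub (ψ := id) hf hfi continuous_id hh hB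

/-- Translation: `∫ h(Λ - y) f(y - a) dy = ∫ f(t) h((Λ - a) - t) dt` (substitute `y = t + a`).
[folklore] -/
theorem integral_mul_comp_sub_translate (h : ℝ → ℝ) (f : ℝ → ℝ) (Λ a : ℝ) :
    ∫ y, h (Λ - y) * f (y - a) = ∫ t, f t * h (Λ - a - t) := by
  rw [← integral_add_right_eq_self (fun y => h (Λ - y) * f (y - a)) a]
  refine integral_congr_ae (Eventually.of_forall fun t => ?_)
  simp only [add_sub_cancel_right]
  rw [mul_comm, show Λ - (t + a) = Λ - a - t by ring]

/-- Commutativity of convolution on `ℝ`: `∫ f(t) g(z - t) dt = ∫ g(t) f(z - t) dt`. [folklore] -/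
theorem integral_mul_sub_comm (f g : ℝ → ℝ) (z : ℝ) :
    ∫ t, f t * g (z - t) = ∫ t, g t * f (z - t) := by
  rw [← integral_sub_left_eq_self (fun t => f t * g (z - t)) volume z]
  refine integral_congr_ae (Eventually.of_forall fun t => ?_)
  simp only [sub_sub_cancel]
  ring

end ShiftAverage

/-! ### Toolkit: integrating against a measure dominated by, or equal to, a density -/

/-- If `μ ≤ g dx` (`g ≥ 0` measurable) and `h ≥ 0` with `g h` integrable, then
`∫ h dμ ≤ ∫ g h dx`. [folklore] -/
theorem integral_le_integral_mul_of_le_withDensity {μ : Measure ℝ} {g h : ℝ → ℝ}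
    (hle : μ ≤ volume.withDensity fun x => ENNReal.ofReal (g x)) (hg0 : ∀ x, 0 ≤ g x)
    (hgm : Measurable g) (hh0 : ∀ x, 0 ≤ h x) (hint : Integrable fun x => g x * h x) :
    ∫ x, h x ∂μ ≤ ∫ x, g x * h x := by
  have hdef : (fun x => ENNReal.ofReal (g x)) = fun x => ((fun x => (g x).toNNReal) x : ℝ≥0∞) := rfl
  have hsmul : (fun x => (g x).toNNReal • h x) = fun x => g x * h x := by
    funext x
    rw [NNReal.smul_def, smul_eq_mul, Real.coe_toNNReal _ (hg0 x)]
  have hkey : ∫ x, h x ∂(volume.withDensity fun x => ENNReal.ofReal (g x)) = ∫ x, g x * h x := by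
    rw [hdef, integral_withDensity_eq_integral_smul hgm.real_toNNReal h, hsmul]
  have hInt : Integrable h (volume.withDensity fun x => ENNReal.ofReal (g x)) := by
    rw [hdef, integrable_withDensity_iff_integrable_smul hgm.real_toNNReal, hsmul]
    exact hint
  rw [← hkey]
  exact integral_mono_measure hle (Eventually.of_forall hh0) hInt

/-- If `μ = g dx` (`g ≥ 0` measurable) then `∫ h dμ = ∫ g h dx` for every `h`. [folklore] -/
theorem integral_eq_integral_mul_of_eq_withDensity {μ : Measure ℝ} {g : ℝ → ℝ}
    (heq : μ = volume.withDensity fun x => ENNReal.ofReal (g x)) (hg0 : ∀ x, 0 ≤ g x)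
    (hgm : Measurable g) (h : ℝ → ℝ) : ∫ x, h x ∂μ = ∫ x, g x * h x := by
  have hdef : (fun x => ENNReal.ofReal (g x)) = fun x => ((fun x => (g x).toNNReal) x : ℝ≥0∞) := rfl
  have hsmul : (fun x => (g x).toNNReal • h x) = fun x => g x * h x := by
    funext x
    rw [NNReal.smul_def, smul_eq_mul, Real.coe_toNNReal _ (hg0 x)]
  rw [heq, hdef, integral_withDensity_eq_integral_smul hgm.real_toNNReal h, hsmul]


/-! ### Step A: the `Λ`-side bootstrap (`σ̃ ≥ 0`, `ν = σ̃ dΛ`, `σ̃ = r ⋄ μ`, `½K ∗ ν = u ⋄ μ`) -/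

section StepA

variable {U : ℝ} {μ ν : Measure ℝ} [IsProbabilityMeasure μ] [IsProbabilityMeasure ν]

/-- Bound `|K_c| ≤ 1/(πc)` in the form used by the toolkit. [folklore] -/
theorem abs_cauchyDensity_le {c : ℝ} (hc : 0 < c) (x : ℝ) : |cauchyDensity c x| ≤ 1 / (π * c) := by
  rw [abs_of_pos (cauchyDensity_pos hc x)]; exact cauchyDensity_le hc x

/-- Bound `|u_c| ≤ 1/(2πc)`. [folklore] -/
theorem abs_fermiKernel_le {c : ℝ} (hc : 0 < c) (x : ℝ) : |fermiKernel c x| ≤ 1 / (2 * π * c) := by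
  rw [abs_of_nonneg (fermiKernel_nonneg hc x)]; exact fermiKernel_le hc x

/-- Bound `|r_c| ≤ 1/(2c)`. [folklore] -/
theorem abs_sechKernel_le {c : ℝ} (hc : 0 < c) (x : ℝ) : |sechKernel c x| ≤ 1 / (2 * c) := by
  rw [abs_of_pos (sechKernel_pos hc x)]; exact sechKernel_le hc x


/-- A continuous function bounded in absolute value is integrable against a finite measure.
[folklore] -/
theorem integrable_of_continuous_of_abs_le {m : Measure ℝ} [IsFiniteMeasure m] {f : ℝ → ℝ}
    (hf : Continuous f) {B : ℝ} (hB : ∀ x, |f x| ≤ B) : Integrable f m :=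
  (integrable_const B).mono' hf.aestronglyMeasurable
    (Eventually.of_forall fun x => by rw [Real.norm_eq_abs]; exact hB x)

/-- `σ̃` is integrable. [folklore] -/
theorem integrable_liebWuLimitDensityΛ (hU : 0 < U) : Integrable (liebWuLimitDensityΛ U μ ν) := by
  have hc : 0 < U / 4 := by positivity
  have hc' : 0 < U / 2 := by positivity
  unfold liebWuLimitDensityΛ
  refine Integrable.sub (Integrable.const_mul ?_ 2) ?_
  · exact integrable_integral_comp_sub (continuous_cauchyDensity hc) (integrable_cauchyDensity hc.le)
      Real.continuous_sin
  · exact integrable_integral_sub (continuous_cauchyDensity hc') (integrable_cauchyDensity hc'.le)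

/-- `∫ σ̃ = 2 - 1 = 1`. [cite: LiebWuPhysicaA2003, §5, Theorem 3] -/
theorem integral_liebWuLimitDensityΛ (hU : 0 < U) : ∫ y, liebWuLimitDensityΛ U μ ν y = 1 := by
  have hc : 0 < U / 4 := by positivity
  have hc' : 0 < U / 2 := by positivity
  unfold liebWuLimitDensityΛ
  rw [integral_sub, integral_const_mul,
    integral_integral_comp_sub (continuous_cauchyDensity hc) (integrable_cauchyDensity hc.le)
      Real.continuous_sin,
    integral_integral_sub (continuous_cauchyDensity hc') (integrable_cauchyDensity hc'.le),
    integral_cauchyDensity hc, integral_cauchyDensity hc']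
  · simp only [measure_univ, ENNReal.toReal_one, mul_one]
    norm_num
  · exact (integrable_integral_comp_sub (continuous_cauchyDensity hc) (integrable_cauchyDensity hc.le)
      Real.continuous_sin).const_mul 2
  · exact integrable_integral_sub (continuous_cauchyDensity hc') (integrable_cauchyDensity hc'.le)

/-- **The identity `σ̃ = r ⋄ μ + u ∗ σ̃ - u ∗ ν`** (Lieb–Wu's `(1 + K̂²)⁻¹ = 1 - Û`,
`(1 + K̂²)⁻¹ 2K̂ = R̂` applied to `σ̃ = 2K ⋄ μ - K² ∗ ν`, here by Fubini and the kernel identities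
`u ∗ K = K - r/2`, `u ∗ K² = K² - u`): for every `Λ`,
`σ̃(Λ) = ∫ r(Λ - sin s) dμ(s) + ∫ u(Λ - y) σ̃(y) dy - ∫ u(Λ - t) dν(t)`.
[cite: LiebWuPhysicaA2003, §5, eq. (U) and the formula for σ preceding Lemma 4] -/
theorem liebWuLimitDensityΛ_eq_sech_add (hU : 0 < U) (Λ : ℝ) :
    liebWuLimitDensityΛ U μ ν Λ =
      (∫ s, sechKernel (U / 4) (Λ - Real.sin s) ∂μ) +
        (∫ y, fermiKernel (U / 4) (Λ - y) * liebWuLimitDensityΛ U μ ν y) -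
        ∫ t, fermiKernel (U / 4) (Λ - t) ∂ν := by
  set c := U / 4 with hcdef
  have hc : 0 < c := by positivity
  have hU2 : U / 2 = 2 * c := by rw [hcdef]; ring
  have hu := continuous_fermiKernel hc
  have huB : ∀ y, |fermiKernel c (Λ - y)| ≤ 1 / (2 * π * c) := fun y => abs_fermiKernel_le hc _
  have huc : Continuous fun y => fermiKernel c (Λ - y) := hu.comp (continuous_const.sub continuous_id)
  -- the two pieces of `σ̃`
  set A : ℝ → ℝ := fun y => ∫ s, cauchyDensity c (y - Real.sin s) ∂μ with hA
  set Bν : ℝ → ℝ := fun y => ∫ t, cauchyDensity (2 * c) (y - t) ∂ν with hB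
  have hσ : ∀ y, liebWuLimitDensityΛ U μ ν y = 2 * A y - Bν y := fun y => by
    simp only [liebWuLimitDensityΛ, hA, hB, ← hcdef, hU2]
  have hAi : Integrable A :=
    integrable_integral_comp_sub (continuous_cauchyDensity hc) (integrable_cauchyDensity hc.le)
      Real.continuous_sin
  have hBi : Integrable Bν :=
    integrable_integral_sub (continuous_cauchyDensity (by positivity : 0 < 2 * c))
      (integrable_cauchyDensity (by positivity : 0 < 2 * c).le)
  -- `∫ u(Λ-y) A(y) dy = ∫ [K(Λ - sin s) - r(Λ - sin s)/2] dμ`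
  have h1 : ∫ y, fermiKernel c (Λ - y) * A y =
      ∫ s, (cauchyDensity c (Λ - Real.sin s) - sechKernel c (Λ - Real.sin s) / 2) ∂μ := by
    simp only [hA]
    rw [integral_mul_integral_comp_sub (continuous_cauchyDensity hc) (integrable_cauchyDensity hc.le)
      Real.continuous_sin huc huB]
    refine integral_congr_ae (Eventually.of_forall fun s => ?_)
    beta_reduce
    rw [integral_mul_comp_sub_translate, integral_mul_sub_comm,
      integral_fermiKernel_mul_cauchyDensity hc]
  -- `∫ u(Λ-y) Bν(y) dy = ∫ [K²(Λ - t) - u(Λ - t)] dν`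
  have h2 : ∫ y, fermiKernel c (Λ - y) * Bν y =
      ∫ t, (cauchyDensity (2 * c) (Λ - t) - fermiKernel c (Λ - t)) ∂ν := by
    simp only [hB]
    rw [integral_mul_integral_sub (continuous_cauchyDensity (by positivity : 0 < 2 * c))
      (integrable_cauchyDensity (by positivity : 0 < 2 * c).le) huc huB]
    refine integral_congr_ae (Eventually.of_forall fun t => ?_)
    beta_reduce
    rw [integral_mul_comp_sub_translate, integral_mul_sub_comm,
      integral_fermiKernel_mul_cauchyDensity_two_mul hc]
  -- assemble
  have hconv : ∫ y, fermiKernel c (Λ - y) * liebWuLimitDensityΛ U μ ν y =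
      2 * (∫ y, fermiKernel c (Λ - y) * A y) - ∫ y, fermiKernel c (Λ - y) * Bν y := by
    simp_rw [hσ]
    have e : ∀ y, fermiKernel c (Λ - y) * (2 * A y - Bν y) =
        2 * (fermiKernel c (Λ - y) * A y) - fermiKernel c (Λ - y) * Bν y := fun y => by ring
    simp_rw [e]
    have hi1 : Integrable fun y => fermiKernel c (Λ - y) * A y :=
      hAi.bdd_mul huc.aestronglyMeasurable (Eventually.of_forall fun y => by
        rw [Real.norm_eq_abs]; exact huB y)
    have hi2 : Integrable fun y => fermiKernel c (Λ - y) * Bν y :=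
      hBi.bdd_mul huc.aestronglyMeasurable (Eventually.of_forall fun y => by
        rw [Real.norm_eq_abs]; exact huB y)
    rw [integral_sub (hi1.const_mul 2) hi2, integral_const_mul]
  rw [hconv, h1, h2, integral_sub, integral_sub, hσ Λ]
  · simp only [hA, hB]
    rw [integral_div]
    ring
  · exact integrable_of_continuous_of_abs_le
      ((continuous_cauchyDensity (by positivity : 0 < 2 * c)).comp (continuous_const.sub continuous_id))
      fun t => abs_cauchyDensity_le (by positivity) _
  · exact integrable_of_continuous_of_abs_le (hu.comp (continuous_const.sub continuous_id))
      fun t => abs_fermiKernel_le hc _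
  · exact integrable_of_continuous_of_abs_le
      ((continuous_cauchyDensity hc).comp (continuous_const.sub Real.continuous_sin))
      fun s => abs_cauchyDensity_le hc _
  · refine integrable_of_continuous_of_abs_le
      (((continuous_sechKernel hc).comp (continuous_const.sub Real.continuous_sin)).div_const 2)
      (B := 1 / (2 * c)) fun s => ?_
    rw [abs_div, abs_two]
    have h0 : 0 ≤ |sechKernel c (Λ - Real.sin s)| := abs_nonneg _
    have h1' := abs_sechKernel_le hc (Λ - Real.sin s)
    linarith

/-- `σ̃⁻ ≤ u ∗ σ̃⁻` when `ν ≤ σ̃⁺ dΛ`: from `σ̃ = r ⋄ μ + u ∗ σ̃ - u ∗ ν ≥ 0 + u ∗ σ̃⁺ - u ∗ σ̃⁻ - u ∗ σ̃⁺`.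
[cite: LiebWuPhysicaA2003, §5, proof of Theorem 1] -/
theorem negPart_liebWuLimitDensityΛ_le (hU : 0 < U)
    (hνle : ν ≤ volume.withDensity fun y => ENNReal.ofReal (max (liebWuLimitDensityΛ U μ ν y) 0))
    (Λ : ℝ) :
    max (-liebWuLimitDensityΛ U μ ν Λ) 0 ≤
      ∫ y, fermiKernel (U / 4) (Λ - y) * max (-liebWuLimitDensityΛ U μ ν y) 0 := by
  set c := U / 4 with hcdef
  have hc : 0 < c := by positivity
  set σ := liebWuLimitDensityΛ U μ ν with hσdef
  have hσc : Continuous σ := continuous_liebWuLimitDensityΛ hU μ ν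
  have hσi : Integrable σ := integrable_liebWuLimitDensityΛ hU
  have hu := continuous_fermiKernel hc
  have huc : Continuous fun y => fermiKernel c (Λ - y) := hu.comp (continuous_const.sub continuous_id)
  have huB : ∀ y, |fermiKernel c (Λ - y)| ≤ 1 / (2 * π * c) := fun y => abs_fermiKernel_le hc _
  -- integrability of `u(Λ - ·) σ^{±}`
  have hip : Integrable fun y => fermiKernel c (Λ - y) * max (σ y) 0 :=
    (hσi.pos_part).bdd_mul huc.aestronglyMeasurable
      (Eventually.of_forall fun y => by rw [Real.norm_eq_abs]; exact huB y)
  have hin : Integrable fun y => fermiKernel c (Λ - y) * max (-σ y) 0 :=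
    (hσi.neg_part).bdd_mul huc.aestronglyMeasurable
      (Eventually.of_forall fun y => by rw [Real.norm_eq_abs]; exact huB y)
  -- `u ∗ ν ≤ u ∗ σ⁺`
  have hUν : ∫ t, fermiKernel c (Λ - t) ∂ν ≤ ∫ y, max (σ y) 0 * fermiKernel c (Λ - y) := by
    refine integral_le_integral_mul_of_le_withDensity hνle (fun y => le_max_right _ _)
      ((hσc.max continuous_const).measurable) (fun y => fermiKernel_nonneg hc _) ?_
    simpa only [mul_comm] using hip
  -- `u ∗ σ = u ∗ σ⁺ - u ∗ σ⁻`
  have hsplit : ∫ y, fermiKernel c (Λ - y) * σ y =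
      (∫ y, fermiKernel c (Λ - y) * max (σ y) 0) - ∫ y, fermiKernel c (Λ - y) * max (-σ y) 0 := by
    rw [← integral_sub hip hin]
    refine integral_congr_ae (Eventually.of_forall fun y => ?_)
    have : σ y = max (σ y) 0 - max (-σ y) 0 := (max_zero_sub_max_neg_zero_eq_self (σ y)).symm
    beta_reduce
    rw [← mul_sub, ← this]
  -- `r ⋄ μ ≥ 0`
  have hR : 0 ≤ ∫ s, sechKernel c (Λ - Real.sin s) ∂μ :=
    integral_nonneg fun s => (sechKernel_pos hc _).le
  have hmain := liebWuLimitDensityΛ_eq_sech_add (μ := μ) (ν := ν) hU Λ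
  rw [← hσdef, ← hcdef] at hmain
  have hcomm : ∫ y, max (σ y) 0 * fermiKernel c (Λ - y) = ∫ y, fermiKernel c (Λ - y) * max (σ y) 0 := by
    simp_rw [mul_comm]
  rw [hcomm] at hUν
  have hnonneg : 0 ≤ ∫ y, fermiKernel c (Λ - y) * max (-σ y) 0 :=
    integral_nonneg fun y => mul_nonneg (fermiKernel_nonneg hc _) (le_max_right _ _)
  refine max_le ?_ hnonneg
  linarith [hsplit, hmain, hR, hUν]

/-- **`σ̃ ≥ 0`** when `ν ≤ σ̃⁺ dΛ` (the contraction: `σ̃⁻ ≤ u ∗ σ̃⁻`, `∫ u = 1/2 < 1`, so `σ̃⁻ = 0`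
a.e., hence everywhere by continuity). [cite: LiebWuPhysicaA2003, §5, proof of Theorem 1] -/
theorem liebWuLimitDensityΛ_nonneg (hU : 0 < U)
    (hνle : ν ≤ volume.withDensity fun y => ENNReal.ofReal (max (liebWuLimitDensityΛ U μ ν y) 0))
    (Λ : ℝ) : 0 ≤ liebWuLimitDensityΛ U μ ν Λ := by
  set c := U / 4 with hcdef
  have hc : 0 < c := by positivity
  set σ := liebWuLimitDensityΛ U μ ν with hσdef
  have hσc : Continuous σ := continuous_liebWuLimitDensityΛ hU μ ν
  have hσi : Integrable σ := integrable_liebWuLimitDensityΛ hU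
  set g : ℝ → ℝ := fun y => max (-σ y) 0 with hg
  have hgc : Continuous g := (hσc.neg).max continuous_const
  have hg0 : g =ᵐ[volume] 0 := by
    refine Literature.MeasureTheory.Lebesgue.ae_eq_zero_of_le_integral_sub
      (continuous_fermiKernel hc).measurable hgc.measurable (fermiKernel_nonneg hc)
      (fun y => le_max_right _ _) (integrable_fermiKernel hc) hσi.neg_part ?_
      (Eventually.of_forall fun x => ?_)
    · rw [integral_fermiKernel hc]; norm_num
    · exact negPart_liebWuLimitDensityΛ_le hU hνle x
  have hgz : g = 0 := (Continuous.ae_eq_iff_eq volume hgc continuous_const).1 hg0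
  have h1 := congrFun hgz Λ
  simp only [hg, Pi.zero_apply] at h1
  linarith [le_max_left (-σ Λ) 0]

/-- **`ν = σ̃ dΛ`**: the limit of the `Λ`-distribution is absolutely continuous with density
`σ̃ ≥ 0` (squeeze: `ν ≤ σ̃ dΛ` and `∫ σ̃ = 1 = ν(ℝ)`). [cite: Goldbaum2005, §5, eq. (5.11)] -/
theorem rapidityLimit_eq_withDensity (hU : 0 < U)
    (hνle : ν ≤ volume.withDensity fun y => ENNReal.ofReal (max (liebWuLimitDensityΛ U μ ν y) 0)) :
    ν = volume.withDensity fun y => ENNReal.ofReal (liebWuLimitDensityΛ U μ ν y) := by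
  have h0 := liebWuLimitDensityΛ_nonneg hU hνle
  have hmax : (fun y => ENNReal.ofReal (max (liebWuLimitDensityΛ U μ ν y) 0)) =
      fun y => ENNReal.ofReal (liebWuLimitDensityΛ U μ ν y) := by
    funext y; rw [max_eq_left (h0 y)]
  rw [hmax] at hνle
  refine Literature.MeasureTheory.Lebesgue.measure_eq_withDensity_of_le h0
    (integrable_liebWuLimitDensityΛ hU) hνle ?_
  rw [integral_liebWuLimitDensityΛ hU, measure_univ]
  simp

/-- **`σ̃ = r ⋄ μ`**: once `ν = σ̃ dΛ`, the identity `σ̃ = r ⋄ μ + u ∗ σ̃ - u ∗ ν` collapses to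
`σ̃(Λ) = ∫ r(Λ - sin s) dμ(s)` (Lieb–Wu's `σ = R̂ (ρ ∘ sin)`).
[cite: LiebWuPhysicaA2003, §5, formula for σ preceding Lemma 4] -/
theorem liebWuLimitDensityΛ_eq_integral_sechKernel (hU : 0 < U)
    (hνle : ν ≤ volume.withDensity fun y => ENNReal.ofReal (max (liebWuLimitDensityΛ U μ ν y) 0))
    (Λ : ℝ) : liebWuLimitDensityΛ U μ ν Λ = ∫ s, sechKernel (U / 4) (Λ - Real.sin s) ∂μ := by
  have hν := rapidityLimit_eq_withDensity hU hνle
  have h0 := liebWuLimitDensityΛ_nonneg hU hνle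
  have hσc : Continuous (liebWuLimitDensityΛ U μ ν) := continuous_liebWuLimitDensityΛ hU μ ν
  have hmain := liebWuLimitDensityΛ_eq_sech_add (μ := μ) (ν := ν) hU Λ
  have hUν : ∫ t, fermiKernel (U / 4) (Λ - t) ∂ν =
      ∫ y, fermiKernel (U / 4) (Λ - y) * liebWuLimitDensityΛ U μ ν y := by
    rw [integral_eq_integral_mul_of_eq_withDensity hν h0 hσc.measurable]
    simp_rw [mul_comm]
  linarith

/-- **`½ K ∗ ν = u ⋄ μ`**: for every `x`,
`½ ∫ K_{U/4}(x - t) dν(t) = ∫ u(x - sin s) dμ(s)` (`ν = (r ⋄ μ) dΛ`, Fubini, and `K ∗ r = 2u`),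
so that the limit density of the momenta is `ρ̃(k) = 1/2π + cos k · (u ⋄ μ)(sin k)`.
[cite: LiebWuPhysicaA2003, §5, eq. (U)] -/
theorem integral_cauchyDensity_rapidityLimit (hU : 0 < U)
    (hνle : ν ≤ volume.withDensity fun y => ENNReal.ofReal (max (liebWuLimitDensityΛ U μ ν y) 0))
    (x : ℝ) :
    (1 / 2) * ∫ t, cauchyDensity (U / 4) (x - t) ∂ν = ∫ s, fermiKernel (U / 4) (x - Real.sin s) ∂μ := by
  set c := U / 4 with hcdef
  have hc : 0 < c := by positivity
  have hν := rapidityLimit_eq_withDensity hU hνle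
  have h0 := liebWuLimitDensityΛ_nonneg hU hνle
  have hσc : Continuous (liebWuLimitDensityΛ U μ ν) := continuous_liebWuLimitDensityΛ hU μ ν
  have hKc : Continuous fun t => cauchyDensity c (x - t) :=
    (continuous_cauchyDensity hc).comp (continuous_const.sub continuous_id)
  have hKB : ∀ t, |cauchyDensity c (x - t)| ≤ 1 / (π * c) := fun t => abs_cauchyDensity_le hc _
  rw [integral_eq_integral_mul_of_eq_withDensity hν h0 hσc.measurable]
  have hσ : ∀ t, liebWuLimitDensityΛ U μ ν t = ∫ s, sechKernel c (t - Real.sin s) ∂μ :=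
    fun t => liebWuLimitDensityΛ_eq_integral_sechKernel hU hνle t
  simp_rw [hσ]
  have hswap : ∫ t, (∫ s, sechKernel c (t - Real.sin s) ∂μ) * cauchyDensity c (x - t) =
      ∫ t, cauchyDensity c (x - t) * (∫ s, sechKernel c (t - Real.sin s) ∂μ) := by
    simp_rw [mul_comm]
  rw [hswap, integral_mul_integral_comp_sub (continuous_sechKernel hc) (integrable_sechKernel hc)
    Real.continuous_sin hKc hKB, ← integral_const_mul]
  refine integral_congr_ae (Eventually.of_forall fun s => ?_)
  beta_reduce
  rw [integral_mul_comp_sub_translate, integral_sechKernel_mul_cauchyDensity hc]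
  ring

/-- The momentum limit density in bootstrap form: `ρ̃_ν(k) = 1/2π + cos k · ∫ u(sin k - sin s) dμ(s)`.
[cite: LiebWuPhysicaA2003, §5, eq. (U)] -/
theorem liebWuLimitDensityK_eq_fermiKernel (hU : 0 < U)
    (hνle : ν ≤ volume.withDensity fun y => ENNReal.ofReal (max (liebWuLimitDensityΛ U μ ν y) 0))
    (k : ℝ) :
    liebWuLimitDensityK U ν k =
      1 / (2 * π) + Real.cos k * ∫ s, fermiKernel (U / 4) (Real.sin k - Real.sin s) ∂μ := by
  rw [liebWuLimitDensityK, integral_cauchyDensity_rapidityLimit hU hνle]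

end StepA


/-! ### Step B: the `k`-side bootstrap -/

/-! #### Calculus on the circle: folding `[-π, π]` onto `[-π/2, π/2]` along `sin` -/

/-- `sin(π - θ) = sin θ`, `cos(π - θ) = -cos θ`, `sin(-π - θ) = sin θ`, `cos(-π - θ) = -cos θ`.
[folklore] -/
theorem sin_neg_pi_sub_eq (θ : ℝ) : Real.sin (-π - θ) = Real.sin θ := by
  rw [show -π - θ = -(θ + π) by ring, Real.sin_neg, Real.sin_add_pi, neg_neg]

/-- See `sin_neg_pi_sub_eq`. [folklore] -/
theorem cos_neg_pi_sub_eq (θ : ℝ) : Real.cos (-π - θ) = -Real.cos θ := by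
  rw [show -π - θ = -(θ + π) by ring, Real.cos_neg, Real.cos_add_pi]

/-- **Folding `[-π, π]`**: for a continuous `H`,
`∫_{-π}^{π} H = ∫_{-π/2}^{π/2} H(θ) dθ + ∫_0^{π/2} H(π - θ) dθ + ∫_{-π/2}^0 H(-π - θ) dθ`
(the three arcs `[-π/2, π/2]`, `[π/2, π]`, `[-π, -π/2]`, the outer two reparametrised by the angle
`θ` with the same sine). [folklore] -/
theorem integral_neg_pi_pi_fold {H : ℝ → ℝ} (hH : Continuous H) :
    ∫ s in (-π)..π, H s = (∫ θ in (-(π / 2))..(π / 2), H θ) +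
      (∫ θ in (0 : ℝ)..(π / 2), H (π - θ)) + ∫ θ in (-(π / 2))..0, H (-π - θ) := by
  have hi : ∀ a b : ℝ, IntervalIntegrable H volume a b := fun a b => hH.intervalIntegrable a b
  have h1 : ∫ s in (-π)..π, H s = (∫ s in (-π)..(-(π / 2)), H s) + ∫ s in (-(π / 2))..π, H s :=
    (intervalIntegral.integral_add_adjacent_intervals (hi _ _) (hi _ _)).symm
  have h2 : ∫ s in (-(π / 2))..π, H s = (∫ s in (-(π / 2))..(π / 2), H s) + ∫ s in (π / 2)..π, H s :=
    (intervalIntegral.integral_add_adjacent_intervals (hi _ _) (hi _ _)).symm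
  have h3 : ∫ θ in (0 : ℝ)..(π / 2), H (π - θ) = ∫ s in (π / 2)..π, H s := by
    rw [intervalIntegral.integral_comp_sub_left (fun s => H s) π, sub_zero,
      show π - π / 2 = π / 2 by ring]
  have h4 : ∫ θ in (-(π / 2))..0, H (-π - θ) = ∫ s in (-π)..(-(π / 2)), H s := by
    rw [intervalIntegral.integral_comp_sub_left (fun s => H s) (-π)]
    congr 1 <;> ring
  rw [h1, h2, h3, h4]
  ring

/-- `∫_{-π}^{π} g(sin s) ds = 2 ∫_{-π/2}^{π/2} g(sin θ) dθ` for continuous `g`. [folklore] -/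
theorem integral_comp_sin_neg_pi_pi {g : ℝ → ℝ} (hg : Continuous g) :
    ∫ s in (-π)..π, g (Real.sin s) = 2 * ∫ θ in (-(π / 2))..(π / 2), g (Real.sin θ) := by
  rw [integral_neg_pi_pi_fold (H := fun s => g (Real.sin s)) (by fun_prop)]
  simp only [Real.sin_pi_sub, sin_neg_pi_sub_eq]
  have hi : ∀ a b : ℝ, IntervalIntegrable (fun θ => g (Real.sin θ)) volume a b := fun a b =>
    (hg.comp Real.continuous_sin).intervalIntegrable a b
  have h := intervalIntegral.integral_add_adjacent_intervals (hi (-(π / 2)) 0) (hi 0 (π / 2))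
  linarith

/-- `∫_{-π}^{π} cos s · g(sin s) ds = 0` for continuous `g` (the integrand is the derivative of
`G(sin s)`, `G' = g`). [folklore] -/
theorem integral_cos_mul_comp_sin_eq_zero {g : ℝ → ℝ} (hg : Continuous g) :
    ∫ s in (-π)..π, Real.cos s * g (Real.sin s) = 0 := by
  set G : ℝ → ℝ := fun y => ∫ t in (0 : ℝ)..y, g t with hG
  have hGd : ∀ y, HasDerivAt G (g y) y := fun y =>
    intervalIntegral.integral_hasDerivAt_right (hg.intervalIntegrable _ _)
      (hg.stronglyMeasurableAtFilter _ _) hg.continuousAt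
  have hderiv : ∀ s ∈ Set.uIcc (-π) π, HasDerivAt (fun s => G (Real.sin s))
      (Real.cos s * g (Real.sin s)) s := by
    intro s _
    have h2 : HasDerivAt (fun s => G (Real.sin s)) (g (Real.sin s) * Real.cos s) s :=
      (hGd (Real.sin s)).comp s (Real.hasDerivAt_sin s)
    exact h2.congr_deriv (mul_comm _ _)
  have hint : IntervalIntegrable (fun s => Real.cos s * g (Real.sin s)) volume (-π) π :=
    (Real.continuous_cos.mul (hg.comp Real.continuous_sin)).intervalIntegrable _ _
  rw [intervalIntegral.integral_eq_sub_of_hasDerivAt hderiv hint]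
  simp

/-! #### The function `F = u ⋄ μ` and the fold inequality -/

/-- `0 ≤ (u ⋄ μ)(x) = ∫ u(x - sin s) dμ(s)`. [folklore] -/
theorem sinAverage_fermiKernel_nonneg {U : ℝ} (hU : 0 < U) (μ : Measure ℝ) (x : ℝ) :
    0 ≤ ∫ s, fermiKernel (U / 4) (x - Real.sin s) ∂μ :=
  integral_nonneg fun s => fermiKernel_nonneg (by positivity) _

/-- `u ⋄ μ` is continuous. [folklore] -/
theorem continuous_sinAverage_fermiKernel {U : ℝ} (hU : 0 < U) (μ : Measure ℝ) [IsFiniteMeasure μ] :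
    Continuous fun x => ∫ s, fermiKernel (U / 4) (x - Real.sin s) ∂μ :=
  continuous_integral_comp_sub (continuous_fermiKernel (by positivity))
    (fun x => abs_fermiKernel_le (by positivity) x) Real.continuous_sin

section StepB

variable {U : ℝ} {μ ν : Measure ℝ} [IsProbabilityMeasure μ] [IsProbabilityMeasure ν]

omit [IsProbabilityMeasure μ] in
/-- **From `μ ≤ ρ̃⁺ dk` on `[-π, π]` to an integral inequality**: for continuous `h ≥ 0`,
`∫ h dμ ≤ ∫_{-π}^{π} ρ̃⁺ h`. [cite: Goldbaum2005, §5, eq. (5.10)] -/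
theorem integral_rootLimit_le (hU : 0 < U)
    (hμle : μ ≤ volume.withDensity fun x => ENNReal.ofReal (max (liebWuLimitDensityK U ν x) 0))
    (hμsupp : μ (Icc (-π) π)ᶜ = 0) {h : ℝ → ℝ} (hh : Continuous h) (hh0 : ∀ x, 0 ≤ h x) :
    ∫ x, h x ∂μ ≤ ∫ x in (-π)..π, max (liebWuLimitDensityK U ν x) 0 * h x := by
  set ρ : ℝ → ℝ := fun x => max (liebWuLimitDensityK U ν x) 0 with hρ
  have hρc : Continuous ρ := (continuous_liebWuLimitDensityK hU ν).max continuous_const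
  have hρ0 : ∀ x, 0 ≤ ρ x := fun x => le_max_right _ _
  -- `μ = μ|[-π,π] ≤ (ρ dx)|[-π,π] = (1_{[-π,π]} ρ) dx`
  have hae : ∀ᵐ x ∂μ, x ∈ Icc (-π) π := mem_ae_iff.2 hμsupp
  have hrestr : μ.restrict (Icc (-π) π) = μ := Measure.restrict_eq_self_of_ae_mem hae
  have hle : μ ≤ volume.withDensity fun x => ENNReal.ofReal ((Icc (-π) π).indicator ρ x) := by
    have hind : (fun x => ENNReal.ofReal ((Icc (-π) π).indicator ρ x)) =
        (Icc (-π) π).indicator fun x => ENNReal.ofReal (ρ x) := by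
      funext x
      by_cases hx : x ∈ Icc (-π) π <;> simp [hx]
    rw [hind, withDensity_indicator measurableSet_Icc, ← restrict_withDensity measurableSet_Icc,
      ← hrestr]
    exact Measure.restrict_mono le_rfl hμle
  have hind0 : ∀ x, 0 ≤ (Icc (-π) π).indicator ρ x := fun x =>
    Set.indicator_nonneg (fun y _ => hρ0 y) x
  have hint : Integrable fun x => (Icc (-π) π).indicator ρ x * h x := by
    have : (fun x => (Icc (-π) π).indicator ρ x * h x) = (Icc (-π) π).indicator fun x => ρ x * h x := by
      funext x
      by_cases hx : x ∈ Icc (-π) π <;> simp [hx]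
    rw [this]
    exact ((hρc.mul hh).integrableOn_Icc).integrable_indicator measurableSet_Icc
  calc ∫ x, h x ∂μ ≤ ∫ x, (Icc (-π) π).indicator ρ x * h x :=
        integral_le_integral_mul_of_le_withDensity hle hind0
          ((hρc.measurable).indicator measurableSet_Icc) hh0 hint
    _ = ∫ x in Icc (-π) π, ρ x * h x := by
        rw [← integral_indicator measurableSet_Icc]
        refine integral_congr_ae (Eventually.of_forall fun x => ?_)
        by_cases hx : x ∈ Icc (-π) π <;> simp [hx]
    _ = ∫ x in (-π)..π, ρ x * h x := by
        rw [intervalIntegral.integral_of_le (by linarith [Real.pi_pos]), integral_Icc_eq_integral_Ioc]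

/-- Elementary identity `(a + b) + (a - b)⁺ = 2a + (b - a)⁺`. [folklore] -/
theorem add_add_max_sub_eq (a b : ℝ) : (a + b) + max (a - b) 0 = 2 * a + max (b - a) 0 := by
  rcases le_total b a with h | h
  · rw [max_eq_left (by linarith), max_eq_right (by linarith)]; ring
  · rw [max_eq_right (by linarith), max_eq_left (by linarith)]; ring

/-- **The fold inequality.** With `F = u ⋄ μ`, `ρ̃(s) = 1/2π + cos s · F(sin s)` and
`G(θ) = (cos θ · F(sin θ) - 1/2π)⁺`: for every `x`,
`F(x) ≤ π⁻¹ ∫_{-π/2}^{π/2} u(x - sin θ) dθ + ∫_{-π/2}^{π/2} G(θ) u(x - sin θ) dθ`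
(from `μ ≤ ρ̃⁺ dk` on `[-π, π]`, folding the three arcs onto `[-π/2, π/2]`, and
`ρ̃ + (ρ̃ ∘ reflection)⁺ = 1/π + G` pointwise). [cite: LiebWuPhysicaA2003, §6 Lemma 5] -/
theorem sinAverage_fermiKernel_le_fold (hU : 0 < U)
    (hνle : ν ≤ volume.withDensity fun y => ENNReal.ofReal (max (liebWuLimitDensityΛ U μ ν y) 0))
    (hμle : μ ≤ volume.withDensity fun x => ENNReal.ofReal (max (liebWuLimitDensityK U ν x) 0))
    (hμsupp : μ (Icc (-π) π)ᶜ = 0) (x : ℝ) :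
    ∫ s, fermiKernel (U / 4) (x - Real.sin s) ∂μ ≤
      π⁻¹ * (∫ θ in (-(π / 2))..(π / 2), fermiKernel (U / 4) (x - Real.sin θ)) +
        ∫ θ in (-(π / 2))..(π / 2),
          max (Real.cos θ * (∫ s, fermiKernel (U / 4) (Real.sin θ - Real.sin s) ∂μ) - 1 / (2 * π)) 0 *
            fermiKernel (U / 4) (x - Real.sin θ) := by
  set c := U / 4 with hcdef
  have hc : 0 < c := by positivity
  set F : ℝ → ℝ := fun y => ∫ s, fermiKernel c (y - Real.sin s) ∂μ with hFdef
  have hFc : Continuous F := continuous_sinAverage_fermiKernel hU μ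
  have hF0 : ∀ y, 0 ≤ F y := fun y => sinAverage_fermiKernel_nonneg hU μ y
  have hu : Continuous (fermiKernel c) := continuous_fermiKernel hc
  have hux : Continuous fun s => fermiKernel c (x - Real.sin s) :=
    hu.comp (continuous_const.sub Real.continuous_sin)
  have hρ : ∀ s, liebWuLimitDensityK U ν s = 1 / (2 * π) + Real.cos s * F (Real.sin s) :=
    fun s => liebWuLimitDensityK_eq_fermiKernel hU hνle s
  -- step 1: `F x ≤ ∫_{-π}^{π} ρ̃⁺(s) u(x - sin s) ds`
  have h1 := integral_rootLimit_le hU hμle hμsupp hux fun s => fermiKernel_nonneg hc _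
  refine h1.trans (le_of_eq ?_)
  -- step 2: fold
  set H : ℝ → ℝ := fun s => max (liebWuLimitDensityK U ν s) 0 * fermiKernel c (x - Real.sin s) with hH
  have hHc : Continuous H :=
    ((continuous_liebWuLimitDensityK hU ν).max continuous_const).mul hux
  rw [integral_neg_pi_pi_fold hHc]
  -- the three integrands on `[-π/2, π/2]`
  have hmid : ∀ θ ∈ uIcc (-(π / 2)) (π / 2),
      H θ = (1 / (2 * π) + Real.cos θ * F (Real.sin θ)) * fermiKernel c (x - Real.sin θ) := by
    intro θ hθ
    rw [Set.uIcc_of_le (by linarith [Real.pi_pos])] at hθ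
    simp only [hH, hρ]
    rw [max_eq_left]
    have hcos : 0 ≤ Real.cos θ := Real.cos_nonneg_of_mem_Icc hθ
    have := hF0 (Real.sin θ)
    positivity
  have hout : ∀ θ, H (π - θ) = max (1 / (2 * π) - Real.cos θ * F (Real.sin θ)) 0 *
      fermiKernel c (x - Real.sin θ) := by
    intro θ
    simp only [hH, hρ, Real.sin_pi_sub, Real.cos_pi_sub]
    ring_nf
  have hout' : ∀ θ, H (-π - θ) = max (1 / (2 * π) - Real.cos θ * F (Real.sin θ)) 0 *
      fermiKernel c (x - Real.sin θ) := by
    intro θ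
    simp only [hH, hρ, sin_neg_pi_sub_eq, cos_neg_pi_sub_eq]
    ring_nf
  simp_rw [hout, hout']
  set P : ℝ → ℝ := fun θ => max (1 / (2 * π) - Real.cos θ * F (Real.sin θ)) 0 *
      fermiKernel c (x - Real.sin θ) with hP
  have hPc : Continuous P :=
    ((continuous_const.sub (Real.continuous_cos.mul (hFc.comp Real.continuous_sin))).max
      continuous_const).mul hux
  have hcomb : (∫ θ in (0 : ℝ)..(π / 2), P θ) + ∫ θ in (-(π / 2))..0, P θ =
      ∫ θ in (-(π / 2))..(π / 2), P θ := by
    rw [add_comm]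
    exact intervalIntegral.integral_add_adjacent_intervals (hPc.intervalIntegrable _ _)
      (hPc.intervalIntegrable _ _)
  have hfirst : ∫ θ in (-(π / 2))..(π / 2), H θ = ∫ θ in (-(π / 2))..(π / 2),
      (1 / (2 * π) + Real.cos θ * F (Real.sin θ)) * fermiKernel c (x - Real.sin θ) :=
    intervalIntegral.integral_congr hmid
  have hQc : Continuous fun θ => (1 / (2 * π) + Real.cos θ * F (Real.sin θ)) *
      fermiKernel c (x - Real.sin θ) :=
    (continuous_const.add (Real.continuous_cos.mul (hFc.comp Real.continuous_sin))).mul hux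
  have hGc : Continuous fun θ => max (Real.cos θ * F (Real.sin θ) - 1 / (2 * π)) 0 *
      fermiKernel c (x - Real.sin θ) :=
    (((Real.continuous_cos.mul (hFc.comp Real.continuous_sin)).sub continuous_const).max
      continuous_const).mul hux
  rw [add_assoc, hcomb, hfirst, ← intervalIntegral.integral_add (hQc.intervalIntegrable _ _)
    (hPc.intervalIntegrable _ _), ← intervalIntegral.integral_const_mul,
    ← intervalIntegral.integral_add ((hux.const_mul _).intervalIntegrable _ _)
      (hGc.intervalIntegrable _ _)]
  refine intervalIntegral.integral_congr fun θ _ => ?_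
  simp only [hP]
  have hid := add_add_max_sub_eq (1 / (2 * π)) (Real.cos θ * F (Real.sin θ))
  have hπ : (2 : ℝ) * (1 / (2 * π)) = π⁻¹ := by field_simp
  calc (1 / (2 * π) + Real.cos θ * F (Real.sin θ)) * fermiKernel c (x - Real.sin θ) +
        max (1 / (2 * π) - Real.cos θ * F (Real.sin θ)) 0 * fermiKernel c (x - Real.sin θ)
      = ((1 / (2 * π) + Real.cos θ * F (Real.sin θ)) + max (1 / (2 * π) - Real.cos θ * F (Real.sin θ)) 0) *
          fermiKernel c (x - Real.sin θ) := by ring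
    _ = (2 * (1 / (2 * π)) + max (Real.cos θ * F (Real.sin θ) - 1 / (2 * π)) 0) *
          fermiKernel c (x - Real.sin θ) := by rw [hid]
    _ = π⁻¹ * fermiKernel c (x - Real.sin θ) +
          max (Real.cos θ * F (Real.sin θ) - 1 / (2 * π)) 0 * fermiKernel c (x - Real.sin θ) := by
        rw [hπ]; ring

/-- **`G ≤ TG` on `[-π/2, π/2]`**, `TG(θ') = cos θ' ∫_{-π/2}^{π/2} G(θ) u(sin θ' - sin θ) dθ`: the fold
inequality at `x = sin θ'` combined with Lieb–Wu's Lemma 5 in the form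
`∫_{-π/2}^{π/2} u(x - sin θ) dθ < 1/(2√(1 - x²))` (`LiebWuKernels.integral_fermiKernel_sub_sin_lt`).
[cite: LiebWuPhysicaA2003, §6 Lemma 5] -/
theorem foldExcess_le (hU : 0 < U)
    (hνle : ν ≤ volume.withDensity fun y => ENNReal.ofReal (max (liebWuLimitDensityΛ U μ ν y) 0))
    (hμle : μ ≤ volume.withDensity fun x => ENNReal.ofReal (max (liebWuLimitDensityK U ν x) 0))
    (hμsupp : μ (Icc (-π) π)ᶜ = 0) {θ' : ℝ} (hθ' : θ' ∈ Icc (-(π / 2)) (π / 2)) :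
    max (Real.cos θ' * (∫ s, fermiKernel (U / 4) (Real.sin θ' - Real.sin s) ∂μ) - 1 / (2 * π)) 0 ≤
      Real.cos θ' * ∫ θ in (-(π / 2))..(π / 2),
        max (Real.cos θ * (∫ s, fermiKernel (U / 4) (Real.sin θ - Real.sin s) ∂μ) - 1 / (2 * π)) 0 *
          fermiKernel (U / 4) (Real.sin θ' - Real.sin θ) := by
  set c := U / 4 with hcdef
  have hc : 0 < c := by positivity
  set F : ℝ → ℝ := fun y => ∫ s, fermiKernel c (y - Real.sin s) ∂μ with hFdef
  have hF0 : ∀ y, 0 ≤ F y := fun y => sinAverage_fermiKernel_nonneg hU μ y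
  set I : ℝ := ∫ θ in (-(π / 2))..(π / 2), max (Real.cos θ * F (Real.sin θ) - 1 / (2 * π)) 0 *
    fermiKernel c (Real.sin θ' - Real.sin θ) with hI
  have hI0 : 0 ≤ I := intervalIntegral.integral_nonneg (by linarith [Real.pi_pos]) fun θ _ =>
    mul_nonneg (le_max_right _ _) (fermiKernel_nonneg hc _)
  have hcos : 0 ≤ Real.cos θ' := Real.cos_nonneg_of_mem_Icc hθ'
  refine max_le ?_ (mul_nonneg hcos hI0)
  rcases hcos.eq_or_lt with h0 | hpos
  · -- `cos θ' = 0`: both sides vanish up to the harmless `-1/2π`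
    rw [← h0]
    have : 0 < 1 / (2 * π) := by positivity
    linarith
  · have hfold := sinAverage_fermiKernel_le_fold hU hνle hμle hμsupp (Real.sin θ')
    have hsin : |Real.sin θ'| < 1 := abs_sin_lt_one_of_cos_ne_zero hpos.ne'
    have hL5 := integral_fermiKernel_sub_sin_lt hc hsin
    rw [sqrt_one_sub_sin_sq, abs_of_pos hpos] at hL5
    -- `F(sin θ') < 1/(2π cos θ') + I`
    have h1 : F (Real.sin θ') < π⁻¹ * (1 / (2 * Real.cos θ')) + I := by
      have := mul_lt_mul_of_pos_left hL5 (by positivity : (0:ℝ) < π⁻¹)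
      simp only [hFdef, hI] at hfold ⊢
      linarith
    have h2 : Real.cos θ' * F (Real.sin θ') < 1 / (2 * π) + Real.cos θ' * I := by
      have := mul_lt_mul_of_pos_left h1 hpos
      have e : Real.cos θ' * (π⁻¹ * (1 / (2 * Real.cos θ'))) = 1 / (2 * π) := by
        field_simp
      linarith
    simp only [hFdef] at h2
    linarith

/-- `∫_{-π/2}^{π/2} cos θ' u(sin θ' - a) dθ' = ∫_{-1}^{1} u(v - a) dv ≤ ∫ u = 1/2`: the column
integrals of the kernel of `T` are at most `‖Û‖ = 1/2`. [cite: LiebWuPhysicaA2003, §5, proof of Theorem 1] -/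
theorem integral_cos_mul_fermiKernel_sin_sub_le {c : ℝ} (hc : 0 < c) (a : ℝ) :
    ∫ θ in (-(π / 2))..(π / 2), Real.cos θ * fermiKernel c (Real.sin θ - a) ≤ 1 / 2 := by
  have hsub : ∫ θ in (-(π / 2))..(π / 2), Real.cos θ * fermiKernel c (Real.sin θ - a) =
      ∫ v in (-1 : ℝ)..1, fermiKernel c (v - a) := by
    have h := intervalIntegral.integral_comp_mul_deriv (a := -(π / 2)) (b := π / 2)
      (f := Real.sin) (f' := Real.cos) (g := fun v => fermiKernel c (v - a))
      (fun x _ => Real.hasDerivAt_sin x) Real.continuous_cos.continuousOn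
      ((continuous_fermiKernel hc).comp (continuous_id.sub continuous_const))
    simp only [Function.comp, Real.sin_neg, Real.sin_pi_div_two] at h
    rw [← h]
    refine intervalIntegral.integral_congr fun θ _ => ?_
    ring
  rw [hsub, intervalIntegral.integral_of_le (by norm_num), ← integral_fermiKernel hc,
    ← integral_sub_right_eq_self (fermiKernel c) a]
  exact setIntegral_le_integral ((integrable_fermiKernel hc).comp_sub_right a)
    (Eventually.of_forall fun v => fermiKernel_nonneg hc _)

/-- **The `k`-side contraction: `G ≡ 0` on `[-π/2, π/2]`** (`∫ G ≤ ∫ TG ≤ ½ ∫ G`, so `∫ G = 0`, and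
`G ≥ 0` is continuous). Consequently `cos θ · F(sin θ) ≤ 1/(2π)` there.
[cite: LiebWuPhysicaA2003, §6 Lemma 5] -/
theorem cos_mul_sinAverage_le (hU : 0 < U)
    (hνle : ν ≤ volume.withDensity fun y => ENNReal.ofReal (max (liebWuLimitDensityΛ U μ ν y) 0))
    (hμle : μ ≤ volume.withDensity fun x => ENNReal.ofReal (max (liebWuLimitDensityK U ν x) 0))
    (hμsupp : μ (Icc (-π) π)ᶜ = 0) {θ : ℝ} (hθ : θ ∈ Icc (-(π / 2)) (π / 2)) :
    Real.cos θ * (∫ s, fermiKernel (U / 4) (Real.sin θ - Real.sin s) ∂μ) ≤ 1 / (2 * π) := by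
  set c := U / 4 with hcdef
  have hc : 0 < c := by positivity
  set F : ℝ → ℝ := fun y => ∫ s, fermiKernel c (y - Real.sin s) ∂μ with hFdef
  have hFc : Continuous F := continuous_sinAverage_fermiKernel hU μ
  set G : ℝ → ℝ := fun θ => max (Real.cos θ * F (Real.sin θ) - 1 / (2 * π)) 0 with hGdef
  have hGc : Continuous G :=
    ((Real.continuous_cos.mul (hFc.comp Real.continuous_sin)).sub continuous_const).max continuous_const
  have hG0 : ∀ θ, 0 ≤ G θ := fun θ => le_max_right _ _
  have hu := continuous_fermiKernel hc
  have hab : -(π / 2) ≤ π / 2 := by linarith [Real.pi_pos]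
  -- the kernel `k(θ', θ) = cos θ' u(sin θ' - sin θ)` and `TG`
  set kfun : ℝ → ℝ → ℝ := fun θ' θ => G θ * (Real.cos θ' * fermiKernel c (Real.sin θ' - Real.sin θ))
    with hk
  have hkc : Continuous (Function.uncurry kfun) := by
    simp only [hk, Function.uncurry_def]
    fun_prop
  -- `G ≤ TG` pointwise on the interval
  have hGT : ∀ θ' ∈ Icc (-(π / 2)) (π / 2), G θ' ≤ ∫ θ in (-(π / 2))..(π / 2), kfun θ' θ := by
    intro θ' hθ'
    have h := foldExcess_le hU hνle hμle hμsupp hθ'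
    simp only [hGdef, hk, hFdef]
    rw [← intervalIntegral.integral_const_mul] at h
    refine h.trans (le_of_eq (intervalIntegral.integral_congr fun θ _ => ?_))
    ring
  -- `∫ G ≤ ∫∫ k G = ∫ G(θ) (∫ cos θ' u(sin θ' - sin θ) dθ') dθ ≤ ½ ∫ G`
  have hint1 : ∫ θ' in (-(π / 2))..(π / 2), G θ' ≤
      ∫ θ' in (-(π / 2))..(π / 2), ∫ θ in (-(π / 2))..(π / 2), kfun θ' θ :=
    intervalIntegral.integral_mono_on hab (hGc.intervalIntegrable _ _)
      ((intervalIntegral.continuous_parametric_intervalIntegral_of_continuous' hkc _ _).intervalIntegrable _ _)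
      hGT
  have hswap : ∫ θ' in (-(π / 2))..(π / 2), ∫ θ in (-(π / 2))..(π / 2), kfun θ' θ =
      ∫ θ in (-(π / 2))..(π / 2), ∫ θ' in (-(π / 2))..(π / 2), kfun θ' θ := by
    refine intervalIntegral_intervalIntegral_swap ?_
    have hK : IsCompact (Icc (-(π / 2)) (π / 2) ×ˢ Icc (-(π / 2)) (π / 2)) :=
      isCompact_Icc.prod isCompact_Icc
    refine (hkc.continuousOn.integrableOn_compact hK).mono_set ?_
    rw [Set.uIoc_of_le hab]
    exact Set.prod_mono Ioc_subset_Icc_self Ioc_subset_Icc_self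
  have hinner : ∀ θ, ∫ θ' in (-(π / 2))..(π / 2), kfun θ' θ ≤ G θ * (1 / 2) := by
    intro θ
    simp only [hk]
    rw [intervalIntegral.integral_const_mul]
    exact mul_le_mul_of_nonneg_left (integral_cos_mul_fermiKernel_sin_sub_le hc _) (hG0 θ)
  have hkc' : Continuous (Function.uncurry fun θ θ' => kfun θ' θ) := by
    simp only [hk, Function.uncurry_def]
    fun_prop
  have hint2 : ∫ θ in (-(π / 2))..(π / 2), ∫ θ' in (-(π / 2))..(π / 2), kfun θ' θ ≤
      ∫ θ in (-(π / 2))..(π / 2), G θ * (1 / 2) :=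
    intervalIntegral.integral_mono_on hab
      ((intervalIntegral.continuous_parametric_intervalIntegral_of_continuous' hkc' _ _).intervalIntegrable _ _)
      ((hGc.mul continuous_const).intervalIntegrable _ _) fun θ _ => hinner θ
  have hIG0 : 0 ≤ ∫ θ in (-(π / 2))..(π / 2), G θ :=
    intervalIntegral.integral_nonneg hab fun θ _ => hG0 θ
  have hIG : ∫ θ in (-(π / 2))..(π / 2), G θ = 0 := by
    rw [intervalIntegral.integral_mul_const] at hint2
    have := hint1.trans (hswap.le.trans hint2)
    linarith
  -- `G = 0` on the closed interval
  have hGae : ∀ᵐ θ ∂(volume.restrict (Icc (-(π / 2)) (π / 2))), G θ = (0 : ℝ → ℝ) θ := by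
    have hi : IntegrableOn G (Icc (-(π / 2)) (π / 2)) := hGc.integrableOn_Icc
    have h0 : ∫ θ in Icc (-(π / 2)) (π / 2), G θ = 0 := by
      rw [integral_Icc_eq_integral_Ioc, ← intervalIntegral.integral_of_le hab, hIG]
    exact (integral_eq_zero_iff_of_nonneg (fun θ => hG0 θ) hi).1 h0
  have hGz : EqOn G 0 (Icc (-(π / 2)) (π / 2)) :=
    Measure.eqOn_of_ae_eq hGae hGc.continuousOn continuousOn_const (by
      rw [interior_Icc, closure_Ioo (by linarith [Real.pi_pos])])
  have := hGz hθ
  simp only [hGdef, Pi.zero_apply, max_eq_right_iff, sub_nonpos] at this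
  simpa only [hFdef] using this

/-! #### Conclusion: `ρ̃ ≥ 0`, `μ = ρ̃ 1_{[-π,π]} dk`, `ρ̃ = ρ₀` -/

/-- **`ρ̃ ≥ 0` everywhere**: for any `s`, with `θ = arcsin(sin s) ∈ [-π/2, π/2]` one has
`sin θ = sin s`, `cos θ = |cos s|`, so `cos s · F(sin s) ≥ -cos θ · F(sin θ) ≥ -1/(2π)`.
[cite: LiebWuPhysicaA2003, §5, Lemma 3 and §6 Lemma 5] -/
theorem liebWuLimitDensityK_nonneg (hU : 0 < U)
    (hνle : ν ≤ volume.withDensity fun y => ENNReal.ofReal (max (liebWuLimitDensityΛ U μ ν y) 0))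
    (hμle : μ ≤ volume.withDensity fun x => ENNReal.ofReal (max (liebWuLimitDensityK U ν x) 0))
    (hμsupp : μ (Icc (-π) π)ᶜ = 0) (s : ℝ) : 0 ≤ liebWuLimitDensityK U ν s := by
  rw [liebWuLimitDensityK_eq_fermiKernel hU hνle s]
  set θ := Real.arcsin (Real.sin s) with hθ
  have hθmem : θ ∈ Icc (-(π / 2)) (π / 2) := Real.arcsin_mem_Icc _
  have hsin : Real.sin θ = Real.sin s := Real.sin_arcsin (Real.neg_one_le_sin s) (Real.sin_le_one s)
  have hcos : Real.cos θ = |Real.cos s| := by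
    rw [hθ, Real.cos_arcsin, sqrt_one_sub_sin_sq]
  have h := cos_mul_sinAverage_le hU hνle hμle hμsupp hθmem
  rw [hsin, hcos] at h
  have hF0 := sinAverage_fermiKernel_nonneg hU μ (Real.sin s)
  have habs : -(|Real.cos s| * ∫ t, fermiKernel (U / 4) (Real.sin s - Real.sin t) ∂μ) ≤
      Real.cos s * ∫ t, fermiKernel (U / 4) (Real.sin s - Real.sin t) ∂μ := by
    rw [← neg_mul]
    exact mul_le_mul_of_nonneg_right (neg_abs_le _) hF0
  linarith

/-- **Normalisation `∫_{-π}^{π} ρ̃ = 1`** (`∫ cos k F(sin k) dk = 0`). [cite: LiebWuPhysicaA2003, §5, Theorem 3] -/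
theorem integral_liebWuLimitDensityK (hU : 0 < U)
    (hνle : ν ≤ volume.withDensity fun y => ENNReal.ofReal (max (liebWuLimitDensityΛ U μ ν y) 0)) :
    ∫ x in (-π)..π, liebWuLimitDensityK U ν x = 1 := by
  set F : ℝ → ℝ := fun y => ∫ s, fermiKernel (U / 4) (y - Real.sin s) ∂μ with hFdef
  have hFc : Continuous F := continuous_sinAverage_fermiKernel hU μ
  have hρ : ∀ x, liebWuLimitDensityK U ν x = 1 / (2 * π) + Real.cos x * F (Real.sin x) :=
    fun x => liebWuLimitDensityK_eq_fermiKernel hU hνle x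
  simp_rw [hρ]
  rw [intervalIntegral.integral_add (f := fun _ => 1 / (2 * π)) (g := fun x => Real.cos x * F (Real.sin x))
    intervalIntegrable_const ((Real.continuous_cos.mul (hFc.comp' Real.continuous_sin)).intervalIntegrable _ _),
    intervalIntegral.integral_const, integral_cos_mul_comp_sin_eq_zero hFc]
  simp only [smul_eq_mul, add_zero]
  have hπ := Real.pi_pos
  field_simp
  ring

/-- **`μ = ρ̃ 1_{[-π,π]} dk`**: the momentum limit is absolutely continuous with density `ρ̃` on
`[-π, π]` (squeeze: `μ ≤ ρ̃⁺ dk = ρ̃ dk` there, `μ([-π,π]ᶜ) = 0`, `∫_{-π}^{π} ρ̃ = 1 = μ(ℝ)`).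
[cite: Goldbaum2005, §5, eq. (5.10)] -/
theorem rootLimit_eq_withDensity (hU : 0 < U)
    (hνle : ν ≤ volume.withDensity fun y => ENNReal.ofReal (max (liebWuLimitDensityΛ U μ ν y) 0))
    (hμle : μ ≤ volume.withDensity fun x => ENNReal.ofReal (max (liebWuLimitDensityK U ν x) 0))
    (hμsupp : μ (Icc (-π) π)ᶜ = 0) :
    μ = volume.withDensity fun x => ENNReal.ofReal ((Icc (-π) π).indicator (liebWuLimitDensityK U ν) x) := by
  set ρ := liebWuLimitDensityK U ν with hρdef
  have hρc : Continuous ρ := continuous_liebWuLimitDensityK hU ν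
  have hρ0 : ∀ x, 0 ≤ ρ x := fun x => liebWuLimitDensityK_nonneg hU hνle hμle hμsupp x
  have hmax : (fun x => ENNReal.ofReal (max (ρ x) 0)) = fun x => ENNReal.ofReal (ρ x) := by
    funext x; rw [max_eq_left (hρ0 x)]
  rw [hmax] at hμle
  -- domination by the indicator density
  have hae : ∀ᵐ x ∂μ, x ∈ Icc (-π) π := mem_ae_iff.2 hμsupp
  have hrestr : μ.restrict (Icc (-π) π) = μ := Measure.restrict_eq_self_of_ae_mem hae
  have hle : μ ≤ volume.withDensity fun x => ENNReal.ofReal ((Icc (-π) π).indicator ρ x) := by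
    have hind : (fun x => ENNReal.ofReal ((Icc (-π) π).indicator ρ x)) =
        (Icc (-π) π).indicator fun x => ENNReal.ofReal (ρ x) := by
      funext x
      by_cases hx : x ∈ Icc (-π) π <;> simp [hx]
    rw [hind, withDensity_indicator measurableSet_Icc, ← restrict_withDensity measurableSet_Icc,
      ← hrestr]
    exact Measure.restrict_mono le_rfl hμle
  have hind0 : ∀ x, 0 ≤ (Icc (-π) π).indicator ρ x := fun x =>
    Set.indicator_nonneg (fun y _ => hρ0 y) x
  have hindi : Integrable fun x => (Icc (-π) π).indicator ρ x :=
    hρc.integrableOn_Icc.integrable_indicator measurableSet_Icc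
  refine Literature.MeasureTheory.Lebesgue.measure_eq_withDensity_of_le hind0 hindi hle ?_
  rw [integral_indicator measurableSet_Icc, integral_Icc_eq_integral_Ioc,
    ← intervalIntegral.integral_of_le (by linarith [Real.pi_pos]), integral_liebWuLimitDensityK hU hνle,
    measure_univ]
  simp

/-- Integration against the momentum limit: `∫ h dμ = ∫_{-π}^{π} ρ̃ h`. [cite: Goldbaum2005, §5, eq. (5.10)] -/
theorem integral_rootLimit_eq (hU : 0 < U)
    (hνle : ν ≤ volume.withDensity fun y => ENNReal.ofReal (max (liebWuLimitDensityΛ U μ ν y) 0))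
    (hμle : μ ≤ volume.withDensity fun x => ENNReal.ofReal (max (liebWuLimitDensityK U ν x) 0))
    (hμsupp : μ (Icc (-π) π)ᶜ = 0) (h : ℝ → ℝ) :
    ∫ x, h x ∂μ = ∫ x in (-π)..π, liebWuLimitDensityK U ν x * h x := by
  have hρ0 : ∀ x, 0 ≤ liebWuLimitDensityK U ν x := fun x => liebWuLimitDensityK_nonneg hU hνle hμle hμsupp x
  have hρc : Continuous (liebWuLimitDensityK U ν) := continuous_liebWuLimitDensityK hU ν
  rw [integral_eq_integral_mul_of_eq_withDensity (rootLimit_eq_withDensity hU hνle hμle hμsupp)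
    (fun x => Set.indicator_nonneg (fun y _ => hρ0 y) x) ((hρc.measurable).indicator measurableSet_Icc)]
  have : (fun x => (Icc (-π) π).indicator (liebWuLimitDensityK U ν) x * h x) =
      (Icc (-π) π).indicator fun x => liebWuLimitDensityK U ν x * h x := by
    funext x
    by_cases hx : x ∈ Icc (-π) π <;> simp [hx]
  rw [this, integral_indicator measurableSet_Icc, integral_Icc_eq_integral_Ioc,
    ← intervalIntegral.integral_of_le (by linarith [Real.pi_pos])]

/-- **`F = π⁻¹ I(U/2, ·)`**: `∫ u(x - sin s) dμ(s) = π⁻¹ fermiCosJ0 (U/2) x` (substitute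
`μ = ρ̃ dk`, kill the `cos k F(sin k)` part by `∫ cos k g(sin k) dk = 0`, fold the constant part and
use `∫_{-π/2}^{π/2} u(x - sin θ) dθ = I(U/2, x)`). [cite: LiebWuPhysicaA2003, §6, formula for ρ₀(k)] -/
theorem sinAverage_fermiKernel_eq (hU : 0 < U)
    (hνle : ν ≤ volume.withDensity fun y => ENNReal.ofReal (max (liebWuLimitDensityΛ U μ ν y) 0))
    (hμle : μ ≤ volume.withDensity fun x => ENNReal.ofReal (max (liebWuLimitDensityK U ν x) 0))
    (hμsupp : μ (Icc (-π) π)ᶜ = 0) (x : ℝ) :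
    ∫ s, fermiKernel (U / 4) (x - Real.sin s) ∂μ = π⁻¹ * fermiCosJ0 (U / 2) x := by
  set c := U / 4 with hcdef
  have hc : 0 < c := by positivity
  have hU2 : U / 2 = 2 * c := by rw [hcdef]; ring
  set F : ℝ → ℝ := fun y => ∫ s, fermiKernel c (y - Real.sin s) ∂μ with hFdef
  have hFc : Continuous F := continuous_sinAverage_fermiKernel hU μ
  have hu : Continuous (fermiKernel c) := continuous_fermiKernel hc
  have hρ : ∀ s, liebWuLimitDensityK U ν s = 1 / (2 * π) + Real.cos s * F (Real.sin s) :=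
    fun s => liebWuLimitDensityK_eq_fermiKernel hU hνle s
  rw [integral_rootLimit_eq hU hνle hμle hμsupp]
  simp_rw [hρ]
  have e : ∀ s, (1 / (2 * π) + Real.cos s * F (Real.sin s)) * fermiKernel c (x - Real.sin s) =
      (1 / (2 * π)) * fermiKernel c (x - Real.sin s) +
        Real.cos s * (F (Real.sin s) * fermiKernel c (x - Real.sin s)) := fun s => by ring
  simp_rw [e]
  have hi1 : Continuous fun s => (1 / (2 * π)) * fermiKernel c (x - Real.sin s) := by fun_prop
  have hi2 : Continuous fun s => Real.cos s * (F (Real.sin s) * fermiKernel c (x - Real.sin s)) := by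
    fun_prop
  rw [intervalIntegral.integral_add (hi1.intervalIntegrable _ _) (hi2.intervalIntegrable _ _),
    intervalIntegral.integral_const_mul,
    integral_cos_mul_comp_sin_eq_zero (g := fun y => F y * fermiKernel c (x - y)) (by fun_prop),
    integral_comp_sin_neg_pi_pi (g := fun y => fermiKernel c (x - y)) (by fun_prop),
    integral_fermiKernel_sub_sin hc x, hU2]
  have hπ := Real.pi_pos
  field_simp
  ring

/-- **Identification `ρ̃ = ρ₀`** (Lieb–Wu's boxed `ρ₀`, Goldbaum's (5.16)): for every `k`,
`liebWuLimitDensityK U ν k = liebWuRho0 U k`. [cite: Goldbaum2005, §5, eq. (5.16)]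
[cite: LiebWuPhysicaA2003, §6, formula for ρ₀(k)] -/
theorem liebWuLimitDensityK_eq_rho0 (hU : 0 < U)
    (hνle : ν ≤ volume.withDensity fun y => ENNReal.ofReal (max (liebWuLimitDensityΛ U μ ν y) 0))
    (hμle : μ ≤ volume.withDensity fun x => ENNReal.ofReal (max (liebWuLimitDensityK U ν x) 0))
    (hμsupp : μ (Icc (-π) π)ᶜ = 0) (k : ℝ) : liebWuLimitDensityK U ν k = liebWuRho0 U k := by
  rw [liebWuLimitDensityK_eq_fermiKernel hU hνle k, sinAverage_fermiKernel_eq hU hνle hμle hμsupp,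
    liebWuRho0_eq_fermiCosJ0]
  ring

/-- **Movement 2 for one pair of limits**: `∫ g dμ = ∫_{-π}^{π} g ρ₀` for every `g`.
[cite: Goldbaum2005, §5, eq. (5.16)] -/
theorem integral_rootLimit_eq_rho0 (hU : 0 < U)
    (hνle : ν ≤ volume.withDensity fun y => ENNReal.ofReal (max (liebWuLimitDensityΛ U μ ν y) 0))
    (hμle : μ ≤ volume.withDensity fun x => ENNReal.ofReal (max (liebWuLimitDensityK U ν x) 0))
    (hμsupp : μ (Icc (-π) π)ᶜ = 0) (g : ℝ → ℝ) :
    ∫ x, g x ∂μ = ∫ x in (-π)..π, g x * liebWuRho0 U x := by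
  rw [integral_rootLimit_eq hU hνle hμle hμsupp g]
  refine intervalIntegral.integral_congr fun x _ => ?_
  rw [liebWuLimitDensityK_eq_rho0 hU hνle hμle hμsupp, mul_comm]

end StepB

/-! ### Assembly: movement 2 for every family, F3a and F3 -/

/-- **Movement 2 of Goldbaum's thermodynamic limit (CMP 258 (2005) 317, §5, (5.5)–(5.16)),
PROVED**: for `U > 0` and any family of ground-state roots, along every subsequence on which the
empirical distributions of the momenta and of the `Λ`'s both converge weakly (to `ν`, `τ`), the
momentum limit is Lieb–Wu's `ρ₀(k) dk` on `[-π, π]`. Ingredients: the counting inequalities and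
their weak limits (`LiebWuRootCounting`: `ν ≤ ρ̃⁺ dk`, `τ ≤ σ̃⁺ dΛ`, `ν([-π,π]ᶜ) = 0`), the
kernel identities of `LiebWuKernels` (Lieb–Wu 2003, §5, eq. (U)), the contraction
`σ̃⁻ ≤ u ∗ σ̃⁻ ⇒ σ̃⁻ = 0` (`‖Û‖ = 1/2`, positive kernel; `SubconvolutionVanishing`), and on the
`k`-side the fold onto `[-π/2, π/2]` together with Lieb–Wu's Lemma 5
(`∫ u(x - sin θ) dθ < 1/(2√(1-x²))`, `LiebWuRho0Bounds`/`BesselJZeroFermiIntegral`), which forces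
the excess `(cos θ F(sin θ) - 1/2π)⁺` to vanish and identifies `ρ̃ = ρ₀`.
[cite: Goldbaum2005, §5, eq. (5.16)] [cite: LiebWuPhysicaA2003, §5 Theorem 1 and §6] -/
theorem integral_subseqLimit_eq_rho0 {U : ℝ} (hU : 0 < U)
    {k : ∀ m : ℕ, Fin (4 * m + 2) → ℝ} {Λ : ∀ m : ℕ, Fin (2 * m + 1) → ℝ}
    (hk : ∀ m, IsLiebWuGroundRoots U m (k m) (Λ m)) {φ : ℕ → ℕ} (hφ : Tendsto φ atTop atTop)
    {ν τ : ProbabilityMeasure ℝ}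
    (hν : Tendsto (fun n => empiricalProbabilityMeasure (k (φ n))) atTop (𝓝 ν))
    (hτ : Tendsto (fun n => empiricalProbabilityMeasure (Λ (φ n))) atTop (𝓝 τ)) (g : ℝ →ᵇ ℝ) :
    ∫ x, g x ∂(ν : Measure ℝ) = ∫ x in (-π)..π, g x * liebWuRho0 U x := by
  have hμle := rootLimit_le_withDensity hU hk hφ hν hτ
  have hνle := rapidityLimit_le_withDensity hU hk hφ hν hτ
  have hsupp := rootLimit_compl_Icc_eq_zero hk hν
  exact integral_rootLimit_eq_rho0 (μ := (ν : Measure ℝ)) (ν := (τ : Measure ℝ)) hU hνle hμle hsupp g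

/-- **F3a discharged: `goldbaum_rootDensity_tendsto` holds** (Goldbaum 2005, §5: the empirical
distribution of the Bethe momenta of the half-filled Hubbard ring converges weakly to
`ρ₀(k) dk`), by movements 1 and 3 (`LiebWuRootDensityLimit`) and movement 2 above.
[cite: Goldbaum2005, §5, eq. (5.16)] -/
theorem goldbaum_rootDensity_tendsto_holds : goldbaum_rootDensity_tendsto :=
  goldbaum_rootDensity_tendsto_of_subseqLimit fun _U hU _k _Λ hk _φ hφ _ν _τ hν hτ g =>
    integral_subseqLimit_eq_rho0 hU hk hφ hν hτ g

/-- **F3 discharged: `liebWu_betheEnergy_tendsto` holds** — the Bethe-ansatz ground-state energy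
per site of the half-filled Hubbard ring converges to Lieb–Wu's
`-4 ∫₀^∞ J₀(ω)J₁(ω) dω/(ω(1 + e^{ωU/2}))` (F3a and the proved F3c,
`LiebWuThermodynamicLimit.liebWu_betheEnergy_tendsto_of_rootDensity`).
[cite: LiebWuPhysicaA2003, §6, formula for E₀(N_a/2,N_a/2)] [cite: Goldbaum2005, §5, eq. (5.16)] -/
theorem liebWu_betheEnergy_tendsto_holds : liebWu_betheEnergy_tendsto :=
  liebWu_betheEnergy_tendsto_of_rootDensity goldbaum_rootDensity_tendsto_holds

/-! ### Epilogue: the trust base of `lieb_wu` after F1, F3, F4, F5a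

With F1 (Goldbaum's existence theorem, `goldbaum_liebWuGroundRoots_exists_holds`), F3 (above), F4
(`hubbardChain_energyPerSite_limit_exists_holds`), F5a
(`hubbardChain_groundEnergyAt_particleHole_holds`) and the reduction F2c → F2′
(`liebWu_groundEnergyAt_eq_betheEnergy'_of_szSector`) proved, the Lieb–Wu limits `lieb_wu` rest
on exactly two named facts, neither of which has a complete proof in print (module docstring of
`LiebWuBetheAnsatz.lean`, "Rigour status of the nodes"): part (i) on F2c
(`liebWu_minEnergyOn_szSector_eq_betheEnergy`: on the ring of `4m + 2 ≥ 6` sites the Bethe state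
is the ground state of its sector — Lieb–Wu, Physica A 321 (2003) 1, §2: "we are unable to carry
it out and we leave it as an open problem"; Goldbaum, CMP 258 (2005) 317, §4 and §6, argues by
continuity from `U = ∞`, where the lowest level of the half-filled sector is degenerate), and
part (ii) on F5b (`liebWu_muMinus_tendsto`: `E(2n) - E(2n-1) → μ₋(U)`, derived in Lieb–Wu 2003,
§7, to leading order only). -/

/-- **Part (i) of `lieb_wu` from F2c alone.** If on every ring of `4m + 2 ≥ 6` sites the lowest
energy of the sector `(N, S^z) = (4m + 2, 0)` is the Bethe energy of some ground-state roots
(F2c), then the ground-state energy per site of the half-filled rings of even length converges to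
`liebWuEnergy U = -4 ∫₀^∞ J₀(ω)J₁(ω) dω/(ω(1 + e^{ωU/2}))` (F1, F2c → F2′, F3, F4 being proved).
Lieb–Wu, PRL 20 (1968) 1445, eq. (20); Goldbaum, CMP 258 (2005) 317, §§4–5.
[cite: LiebWuPRL1968, eq. (20)] [cite: Goldbaum2005, §§4–5] -/
theorem lieb_wu_energy_of_minEnergyOn_szSector (h₂ : liebWu_minEnergyOn_szSector_eq_betheEnergy)
    {U : ℝ} (hU : 0 < U) :
    Tendsto (fun n : ℕ => energyPerSite (hubbardChain (2 * n)) 1 U (2 * n)) atTop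
      (𝓝 (Literature.Analysis.FunctionSpaces.liebWuEnergy U)) :=
  lieb_wu_energy_of' goldbaum_liebWuGroundRoots_exists_holds
    (liebWu_groundEnergyAt_eq_betheEnergy'_of_szSector h₂) liebWu_betheEnergy_tendsto_holds
    hubbardChain_energyPerSite_limit_exists_holds hU

/-- **Part (ii) of `lieb_wu` from F5b alone.** If `E(2n) - E(2n-1) → μ₋(U)` along the
half-filled rings of even length (F5b), then by particle–hole symmetry (F5a, proved) the charge
gaps `E(2n+1) + E(2n-1) - 2E(2n)` converge to `U - 2μ₋(U) = liebWuChargeGap U`.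
Lieb–Wu, PRL 20 (1968) 1445, eqs. (21)–(23); Essler et al. (2005), eqs. (6.32)–(6.35).
[cite: LiebWuPRL1968, eqs. (21)–(23)] [cite: EsslerEtAl2005, eqs. (6.32)–(6.35)] -/
theorem lieb_wu_chargeGap_of_muMinus_tendsto (h₆ : liebWu_muMinus_tendsto) {U : ℝ} (hU : 0 < U) :
    Tendsto (fun n : ℕ => chargeGap (hubbardChain (2 * n)) 1 U (2 * n)) atTop
      (𝓝 (Literature.Analysis.FunctionSpaces.liebWuChargeGap U)) :=
  lieb_wu_chargeGap_of hubbardChain_groundEnergyAt_particleHole_holds h₆ hU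

/-- **`lieb_wu` from F2c and F5b alone** — the remaining trust base of hubbard.S10 once F1, F3,
F4, F5a and F2c → F2′ are proved: the Bethe state is the ground state of its sector on the rings
of `4m + 2 ≥ 6` sites (F2c, Goldbaum 2005 §4) and `E(2n) - E(2n-1) → μ₋(U)` (F5b, Lieb–Wu 1968
eq. (23) / 2003 §7). [cite: LiebWuPRL1968, eqs. (20)–(23)] [cite: Goldbaum2005, §§4–5]
[cite: LiebWuPhysicaA2003, §§6–7] -/
theorem lieb_wu_of_minEnergyOn_szSector_of_muMinus
    (h₂ : liebWu_minEnergyOn_szSector_eq_betheEnergy) (h₆ : liebWu_muMinus_tendsto) : lieb_wu :=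
  lieb_wu_of_rootDensity h₂ goldbaum_rootDensity_tendsto_holds h₆

end Literature.MathematicalPhysics.QuantumLattice
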